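import Literature.AlgebraicGeometry.Motives.HodgeStructureLefschetzGroupInvariantsDivisorClasses
import Literature.AlgebraicGeometry.Motives.HodgeStructureLefschetzGroupFiniteDirectSumPoints
import HarnessLib

/-!
# Milne 1999, Thm. 3.2 / Prop. 3.4 FOR POWERS (`r ≥ 1`) ON `K`-POINTS: under the DIAGONAL action of `S(H)(K)` on
# `⋀(K ⊗ V^{⊕ι})` ("we obtain an action of `S(A)` on `H^*(A^r)` for all `r`"), the invariants are the `K`-algebra generated
# by the invariant `2`-vectors, i.e. by the divisor `2`-vectors of `H^{⊕ι}` — through "`S(A) = S(A^r)`" (Prop. 1.5)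

[topic AlgebraicGeometry/Motives]

Layer `Literature/AlgebraicGeometry/Motives`, lane `lit-hodgefound` (Track 2 foundations library; seat `lit-hodgefound-p34`,
generation 25, self-proposed row g25-#4), namespace `Literature.AlgebraicGeometry.Motives.HodgeStructure`. THEOREMS ONLY; no
definition, no named fact, no `sorry` (D-0026, net debt `0`).  Sequel of the seat's g25-#2/#3 (`r = 1`:
`Motives/HodgeStructureLefschetzGroupExteriorInvariants`, `…LefschetzGroupInvariantsDivisorClasses`) and g19
`Motives/HodgeStructureLefschetzGroupFiniteDirectSumPoints` (Prop. 1.5 on `K`-points: `S(H^{⊕ι})(K) = Δ S(H)(K)`).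

## The source, verbatim

J. S. Milne, *Lefschetz classes on abelian varieties*, Duke Math. J. **96** (1999) 639–675 [`Milne1999LefschetzClasses`, held
`paper:doi-10-1215-s0012-7094-99-09620-5`; PDF page = printed page − 638], p. 653 (p0015 L20–L36): "From the canonical
isomorphisms `H¹(A) = V(A)^∨`, `H¹(A^r) ≅ rH¹(A)`, `H^*(A^r) ≅ ⋀ H¹(A^r)`, we obtain an action of `S(A)` on `H^*(A^r)` for all
`r`. […] **Theorem 3.2.** For any abelian variety `A` over `Ω` and integer `r ≥ 0`, the `k`-algebra `H^*(A^r)^{S(A)}` is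
generated by divisor classes. […] **Proposition 3.4.** […] `H^*(A^r)^{S(A)} = k[H²(A^r)^{S(A)}]`"; p. 654 L16–L17 (p0016):
"It follows from Proposition 1.5 that `S(A) = S(A^r)`, and so it suffices to prove the statement with `r = 1`."

## What is proved (`H₀` a polarized `ℚ`-Hodge structure of odd weight on `V`, `Q₀` a polarization, `ι` finite non-empty,
`K ⊇ ℚ` a field, `W = K ⊗_ℚ V^{⊕ι}`, `Δ = piDiagEmbedding K V ι : GL(K ⊗ V) → GL(W)` the diagonal action)

* `Polarization.forall_piDiagEmbedding_map_eq_iff` — for `x ∈ ⋀ W`: `⋀(Δγ₀) x = x` for all `γ₀ ∈ S(H₀)(K)` iff `⋀(γ) x = x`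
  for all `γ ∈ S(H₀^{⊕ι})(K)` ("`S(A) = S(A^r)`", the tree's `Polarization.mem_lefschetzGroupBaseChange_pi_const_iff`).
* **`Polarization.setOf_forall_piDiagEmbedding_map_eq_eq_adjoin`** (`K` algebraically closed): the `Δ S(H₀)(K)`-invariants of
  `⋀ W` ARE the `K`-subalgebra generated by the `Δ S(H₀)(K)`-invariant `2`-vectors ("`H^*(A^r)^{S(A)} = k[H²(A^r)^{S(A)}]`",
  every `r ≥ 1`); **`Polarization.setOf_forall_piDiagEmbedding_map_eq_eq_adjoin_divisorTwoVectors`**: … generated by the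
  divisor `2`-vectors of `(H₀^{⊕ι}, Q₀^{⊕ι})` ("the `k`-algebra `H^*(A^r)^{S(A)}` is generated by divisor classes", every
  `r ≥ 1`); membership forms; odd degrees carry no invariants over every `K ⊇ ℚ`
  (`Polarization.eq_zero_of_forall_piDiagEmbedding_map_eq_of_odd`).

NOT here: `r = 0` (trivial: `H^*(A^0) = k`), descent to non-closed `K` (Lemma 3.1), even weight.

## References

* [Milne1999LefschetzClasses] J. S. Milne, Lefschetz classes on abelian varieties, Duke Math. J. 96 (1999) 639–675: §1 Prop.
  1.5 (p. 644), §3 Thm. 3.2, Prop. 3.3, Prop. 3.4 (p. 653), p. 654 L16–L17.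
* [Moonen2004MT] B. Moonen, An introduction to Mumford–Tate groups (2004), §4 Exercise 4.10 (the diagonal action on `V^{⊕ι}`).
-/

noncomputable section

open scoped TensorProduct

namespace Literature.AlgebraicGeometry.Motives

namespace HodgeStructure

open ExteriorLefschetz

universe u uK

variable (K : Type uK) [Field K] [Algebra ℚ K] {ι : Type} [Fintype ι] [DecidableEq ι] [Nonempty ι]
  {V : Type u} [AddCommGroup V] [Module ℚ V] [Module.Finite ℚ V] {n : ℤ} {H₀ : HodgeStructure V n} (Q₀ : Polarization H₀)

omit [Module.Finite ℚ V] in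
/-- **"`S(A) = S(A^r)`" for the action on `⋀`**: an element of `⋀(K ⊗ V^{⊕ι})` is fixed by `⋀(Δγ₀)` for every `γ₀ ∈ S(H₀)(K)`
(the diagonal action of `S(A)` on `H^*(A^r)`) iff it is fixed by `⋀(γ)` for every `γ ∈ S(H₀^{⊕ι})(K)` — because
`S(H₀^{⊕ι})(K) = Δ S(H₀)(K)` (Prop. 1.5 on `K`-points, the tree's `Polarization.mem_lefschetzGroupBaseChange_pi_const_iff`).
[cite: Milne1999LefschetzClasses, §3 p. 653 L20–L23 and p. 654 L16–L17, §1 Prop. 1.5] -/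
theorem Polarization.forall_piDiagEmbedding_map_eq_iff (x : ExteriorAlgebra K (K ⊗[ℚ] (ι → V))) :
    (∀ γ₀ ∈ Q₀.lefschetzGroupBaseChange K,
        ExteriorAlgebra.map (piDiagEmbedding K V ι γ₀ : (K ⊗[ℚ] (ι → V)) →ₗ[K] (K ⊗[ℚ] (ι → V))) x = x) ↔
      ∀ γ ∈ (Polarization.pi fun _ : ι ↦ Q₀).lefschetzGroupBaseChange K,
        ExteriorAlgebra.map (γ : (K ⊗[ℚ] (ι → V)) →ₗ[K] (K ⊗[ℚ] (ι → V))) x = x := by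
  constructor
  · intro h γ hγ
    obtain ⟨γ₀, h₀, rfl⟩ := (Polarization.mem_lefschetzGroupBaseChange_pi_const_iff K Q₀ γ).1 hγ
    exact h γ₀ h₀
  · intro h γ₀ h₀
    exact h _ (Polarization.piDiagEmbedding_mem_lefschetzGroupBaseChange_pi_const K Q₀ h₀)

omit [Module.Finite ℚ V] in
/-- The same for a set of `2`-vectors: the `Δ S(H₀)(K)`-invariant `2`-vectors are the `S(H₀^{⊕ι})(K)`-invariant ones.
[cite: Milne1999LefschetzClasses, §3 p. 654 L16–L17, §1 Prop. 1.5] -/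
theorem Polarization.setOf_mem_exteriorPower_two_and_forall_piDiagEmbedding_map_eq_eq :
    {y : ExteriorAlgebra K (K ⊗[ℚ] (ι → V)) | y ∈ ⋀[K]^2 (K ⊗[ℚ] (ι → V)) ∧ ∀ γ₀ ∈ Q₀.lefschetzGroupBaseChange K,
        ExteriorAlgebra.map (piDiagEmbedding K V ι γ₀ : (K ⊗[ℚ] (ι → V)) →ₗ[K] (K ⊗[ℚ] (ι → V))) y = y} =
      {y : ExteriorAlgebra K (K ⊗[ℚ] (ι → V)) | y ∈ ⋀[K]^2 (K ⊗[ℚ] (ι → V)) ∧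
        ∀ γ ∈ (Polarization.pi fun _ : ι ↦ Q₀).lefschetzGroupBaseChange K,
          ExteriorAlgebra.map (γ : (K ⊗[ℚ] (ι → V)) →ₗ[K] (K ⊗[ℚ] (ι → V))) y = y} := by
  ext y
  simp only [Set.mem_setOf_eq, Polarization.forall_piDiagEmbedding_map_eq_iff K Q₀ y]

set_option maxSynthPendingDepth 4 in
/-- **Milne 1999, Prop. 3.4 for every `r ≥ 1` on `K`-points: "`H^*(A^r)^{S(A)} = k[H²(A^r)^{S(A)}]`"** — for a polarized
`ℚ`-Hodge structure `H₀` of odd weight, a finite non-empty `ι` and `K ⊇ ℚ` algebraically closed, the elements of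
`⋀(K ⊗ V^{⊕ι})` fixed by the DIAGONAL action of `S(H₀)(K)` are exactly the `K`-subalgebra generated by the fixed `2`-vectors
(Prop. 1.5: `S(H₀^{⊕ι})(K) = Δ S(H₀)(K)`, then the `r = 1` statement of the seat's g25-#2 for `H₀^{⊕ι}`).
[cite: Milne1999LefschetzClasses, Thm. 3.2 and Prop. 3.4 (p. 653), p. 654 L16–L17, §1 Prop. 1.5] -/
theorem Polarization.setOf_forall_piDiagEmbedding_map_eq_eq_adjoin [IsAlgClosed K] (hn : Odd n) :
    {x : ExteriorAlgebra K (K ⊗[ℚ] (ι → V)) | ∀ γ₀ ∈ Q₀.lefschetzGroupBaseChange K,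
        ExteriorAlgebra.map (piDiagEmbedding K V ι γ₀ : (K ⊗[ℚ] (ι → V)) →ₗ[K] (K ⊗[ℚ] (ι → V))) x = x} =
      Algebra.adjoin K {y : ExteriorAlgebra K (K ⊗[ℚ] (ι → V)) | y ∈ ⋀[K]^2 (K ⊗[ℚ] (ι → V)) ∧
        ∀ γ₀ ∈ Q₀.lefschetzGroupBaseChange K,
          ExteriorAlgebra.map (piDiagEmbedding K V ι γ₀ : (K ⊗[ℚ] (ι → V)) →ₗ[K] (K ⊗[ℚ] (ι → V))) y = y} := by
  rw [Polarization.setOf_mem_exteriorPower_two_and_forall_piDiagEmbedding_map_eq_eq K Q₀,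
    ← (Polarization.pi fun _ : ι ↦ Q₀).setOf_forall_lefschetzGroupBaseChange_map_eq_eq_adjoin K hn]
  ext x
  simp only [Set.mem_setOf_eq, Polarization.forall_piDiagEmbedding_map_eq_iff K Q₀ x]

set_option maxSynthPendingDepth 4 in
/-- **Milne 1999, Thm. 3.2 for every `r ≥ 1` on `K`-points, as printed: "the `k`-algebra `H^*(A^r)^{S(A)}` is generated by
divisor classes"** — under the hypotheses of the previous statement, the `Δ S(H₀)(K)`-invariants of `⋀(K ⊗ V^{⊕ι})` are the
`K`-subalgebra generated by the divisor `2`-vectors of the polarized Hodge structure `(H₀^{⊕ι}, Q₀^{⊕ι})` (the `2`-vectors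
whose skew form is `(Q₀^{⊕ι}(a ·, ·))_K` for a `†`-symmetric `a ∈ End_HS(H₀^{⊕ι})` — e.g. Milne's product classes
`Σᵢ A × ⋯ × Dᵢ × ⋯ × A` and the graph classes of endomorphisms): Prop. 1.5 and the `r = 1` statement of the seat's g25-#3
for `H₀^{⊕ι}`. [cite: Milne1999LefschetzClasses, Thm. 3.2, Prop. 3.3, Prop. 3.4 (p. 653), p. 654 L16–L17, §1 p. 643 and Prop. 1.5] -/
theorem Polarization.setOf_forall_piDiagEmbedding_map_eq_eq_adjoin_divisorTwoVectors [IsAlgClosed K] (hn : Odd n) :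
    {x : ExteriorAlgebra K (K ⊗[ℚ] (ι → V)) | ∀ γ₀ ∈ Q₀.lefschetzGroupBaseChange K,
        ExteriorAlgebra.map (piDiagEmbedding K V ι γ₀ : (K ⊗[ℚ] (ι → V)) →ₗ[K] (K ⊗[ℚ] (ι → V))) x = x} =
      Algebra.adjoin K {y' : ExteriorAlgebra K (K ⊗[ℚ] (ι → V)) | y' ∈ ⋀[K]^2 (K ⊗[ℚ] (ι → V)) ∧
        ∃ a ∈ (HodgeStructure.pi fun _ : ι ↦ H₀).endAlg, (Polarization.pi fun _ : ι ↦ Q₀).adjoint a = a ∧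
          ∀ v w, contractionForm y' ((Polarization.pi fun _ : ι ↦ Q₀).form.baseChange K v)
              ((Polarization.pi fun _ : ι ↦ Q₀).form.baseChange K w) =
            LinearMap.BilinForm.baseChange K ((Polarization.pi fun _ : ι ↦ Q₀).form ∘ₗ a) v w} := by
  rw [← (Polarization.pi fun _ : ι ↦ Q₀).setOf_forall_lefschetzGroupBaseChange_map_eq_eq_adjoin_divisorTwoVectors K hn]
  ext x
  simp only [Set.mem_setOf_eq, Polarization.forall_piDiagEmbedding_map_eq_iff K Q₀ x]

set_option maxSynthPendingDepth 4 in
/-- Membership form of Prop. 3.4 for powers: a `Δ S(H₀)(K)`-invariant element of `⋀(K ⊗ V^{⊕ι})` is a polynomial in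
`Δ S(H₀)(K)`-invariant `2`-vectors. [cite: Milne1999LefschetzClasses, Prop. 3.4 (p. 653), p. 654 L16–L17] -/
theorem Polarization.mem_adjoin_of_forall_piDiagEmbedding_map_eq [IsAlgClosed K] (hn : Odd n)
    {x : ExteriorAlgebra K (K ⊗[ℚ] (ι → V))}
    (hx : ∀ γ₀ ∈ Q₀.lefschetzGroupBaseChange K,
      ExteriorAlgebra.map (piDiagEmbedding K V ι γ₀ : (K ⊗[ℚ] (ι → V)) →ₗ[K] (K ⊗[ℚ] (ι → V))) x = x) :
    x ∈ Algebra.adjoin K {y : ExteriorAlgebra K (K ⊗[ℚ] (ι → V)) | y ∈ ⋀[K]^2 (K ⊗[ℚ] (ι → V)) ∧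
      ∀ γ₀ ∈ Q₀.lefschetzGroupBaseChange K,
        ExteriorAlgebra.map (piDiagEmbedding K V ι γ₀ : (K ⊗[ℚ] (ι → V)) →ₗ[K] (K ⊗[ℚ] (ι → V))) y = y} := by
  have h : x ∈ {x : ExteriorAlgebra K (K ⊗[ℚ] (ι → V)) | ∀ γ₀ ∈ Q₀.lefschetzGroupBaseChange K,
      ExteriorAlgebra.map (piDiagEmbedding K V ι γ₀ : (K ⊗[ℚ] (ι → V)) →ₗ[K] (K ⊗[ℚ] (ι → V))) x = x} := hx
  rw [Polarization.setOf_forall_piDiagEmbedding_map_eq_eq_adjoin K Q₀ hn] at h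
  exact h

set_option maxSynthPendingDepth 4 in
/-- Membership form of Thm. 3.2 for powers: a `Δ S(H₀)(K)`-invariant element of `⋀(K ⊗ V^{⊕ι})` is a polynomial in the
divisor `2`-vectors of `H₀^{⊕ι}`. [cite: Milne1999LefschetzClasses, Thm. 3.2 (p. 653), p. 654 L16–L17] -/
theorem Polarization.mem_adjoin_divisorTwoVectors_of_forall_piDiagEmbedding_map_eq [IsAlgClosed K] (hn : Odd n)
    {x : ExteriorAlgebra K (K ⊗[ℚ] (ι → V))}
    (hx : ∀ γ₀ ∈ Q₀.lefschetzGroupBaseChange K,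
      ExteriorAlgebra.map (piDiagEmbedding K V ι γ₀ : (K ⊗[ℚ] (ι → V)) →ₗ[K] (K ⊗[ℚ] (ι → V))) x = x) :
    x ∈ Algebra.adjoin K {y' : ExteriorAlgebra K (K ⊗[ℚ] (ι → V)) | y' ∈ ⋀[K]^2 (K ⊗[ℚ] (ι → V)) ∧
      ∃ a ∈ (HodgeStructure.pi fun _ : ι ↦ H₀).endAlg, (Polarization.pi fun _ : ι ↦ Q₀).adjoint a = a ∧
        ∀ v w, contractionForm y' ((Polarization.pi fun _ : ι ↦ Q₀).form.baseChange K v)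
            ((Polarization.pi fun _ : ι ↦ Q₀).form.baseChange K w) =
          LinearMap.BilinForm.baseChange K ((Polarization.pi fun _ : ι ↦ Q₀).form ∘ₗ a) v w} := by
  have h : x ∈ {x : ExteriorAlgebra K (K ⊗[ℚ] (ι → V)) | ∀ γ₀ ∈ Q₀.lefschetzGroupBaseChange K,
      ExteriorAlgebra.map (piDiagEmbedding K V ι γ₀ : (K ⊗[ℚ] (ι → V)) →ₗ[K] (K ⊗[ℚ] (ι → V))) x = x} := hx
  rw [Polarization.setOf_forall_piDiagEmbedding_map_eq_eq_adjoin_divisorTwoVectors K Q₀ hn] at h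
  exact h

omit [Module.Finite ℚ V] in
/-- **Odd degrees carry no invariants of the diagonal action, over every `K ⊇ ℚ`** (`Δ(−1) = −1 ∈ S(H₀^{⊕ι})(K)`).
[cite: Milne1999LefschetzClasses, §3 p. 654] -/
theorem Polarization.eq_zero_of_forall_piDiagEmbedding_map_eq_of_odd {m : ℕ} (hm : Odd m)
    {x : ExteriorAlgebra K (K ⊗[ℚ] (ι → V))} (hxm : x ∈ ⋀[K]^m (K ⊗[ℚ] (ι → V)))
    (hx : ∀ γ₀ ∈ Q₀.lefschetzGroupBaseChange K,
      ExteriorAlgebra.map (piDiagEmbedding K V ι γ₀ : (K ⊗[ℚ] (ι → V)) →ₗ[K] (K ⊗[ℚ] (ι → V))) x = x) : x = 0 :=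
  (Polarization.pi fun _ : ι ↦ Q₀).eq_zero_of_forall_lefschetzGroupBaseChange_map_eq_of_odd K hm hxm
    ((Polarization.forall_piDiagEmbedding_map_eq_iff K Q₀ x).1 hx)

end HodgeStructure

end Literature.AlgebraicGeometry.Motives

end
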